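import Literature.NumberTheory.LFunctions.MauduitRivatTypeIIFourier
import HarnessLib

/-!
# Mauduit–Rivat's type-II estimate for unitary matrices, step 5: tools for the estimate of `S₄` (§6.4 of Mauduit–Rivat 2015; proved)

Everything in this file is PROVED (plus plain definitions). It prepares the estimate of the
expanded sum `S₄(r,s)` (`corrS4r_eq`, `MauduitRivatTypeIIFourier.lean`) along §6.4 of C. Mauduit,
J. Rivat, J. Eur. Math. Soc. 17 (2015) for unitary-matrix weights (C. Müllner, Duke Math. J. 166
(2017), §5.4.2: "The definitions of `S₆` and `S₇` have to be adapted as well"):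

* `sum_range_shift_mod` — cyclic reindexing of sums over a period;
* `S7` — Müllner's `S₇(h₁) = ∑_{x<K'} ‖ĝ(x)ᴴ ĝ(x+h₁)‖_F²` (with `ĝ = dftR K' (U∘g)` at real arguments,
  `K' = k^{μ₂−μ₀}`), `S7_nonneg`, and `sum_S7_le` — MR (81): `∑_{h₁<K'} S₇(h₁) ≤ d²`;
* `sum_sum_norm_sq_ghat_conj_mul_le` — **Lemma 10 with the adjoint on the left**:
  `∑_{h<K'} ∑_{j<k^{λ'}} ‖ĝ(h)ᴴ ĝ(h+j)‖² ≤ d · (Lemma 11 bound)` (same proof as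
  `sum_sum_norm_sq_ghat_mul_le`, since `‖AᴴB‖ ≤ ‖A‖‖B‖`), i.e. `∑_{0≤h₁<k^{λ'}} S₇(h₁)` is small.

## References
* C. Mauduit, J. Rivat, J. Eur. Math. Soc. 17 (2015), §6.4.1 ((73)–(75), (81)). [MauduitRivat2015]
* C. Müllner, Duke Math. J. 166 (2017) = arXiv:1602.03042, §5.4.2 (S₆, S₇), Lemma 5.6. [Mullner2017]
-/

noncomputable section

open Finset Complex Matrix
open scoped FourierTransform InnerProductSpace ComplexConjugate Matrix.Norms.Frobenius

namespace Literature.NumberTheory.LFunctions.MauduitRivat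

open Literature.NumberTheory.Sieve.Vinogradov (geomBound geomBound_nonneg geomBound_neg
  norm_sum_Ioc_fourierChar_le_geomBound)

/-! ## Cyclic reindexing -/

/-- Cyclic shifts do not change sums over a period: `∑_{x<Q} f((x+a) mod Q) = ∑_{x<Q} f(x)`.
[folklore] -/
theorem sum_range_shift_mod {M : Type*} [AddCommMonoid M] (Q : ℕ) (f : ℕ → M) (a : ℕ) :
    ∑ x ∈ range Q, f ((x + a) % Q) = ∑ x ∈ range Q, f x := by
  rcases Nat.eq_zero_or_pos Q with hQ | hQ
  · subst hQ; simp
  have hinj : Set.InjOn (fun x => (x + a) % Q) (range Q) := by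
    intro x hx y hy h
    have hx' := mem_range.1 (mem_coe.1 hx)
    have hy' := mem_range.1 (mem_coe.1 hy)
    have hmod : x + a ≡ y + a [MOD Q] := h
    exact Nat.ModEq.eq_of_lt_of_lt (Nat.ModEq.add_right_cancel' a hmod) hx' hy'
  have himg : (range Q).image (fun x => (x + a) % Q) = range Q := by
    apply eq_of_subset_of_card_le
    · intro y hy
      rw [mem_image] at hy
      obtain ⟨x, -, rfl⟩ := hy
      exact mem_range.2 (Nat.mod_lt _ hQ)
    · rw [card_image_of_injOn hinj]
  rw [← sum_image hinj, himg]

/-! ## `S₇` -/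

variable {d : Type*} [Fintype d] [DecidableEq d] {G : Type*} [Group G]

/-- The discrete Fourier transform `ĝ` at a real frequency (abbreviation). [cite: MauduitRivat2015, (71)] -/
def ghatR (U : G →* unitaryGroup d ℂ) (f : ℕ → G) (k μ₀ μ₁ μ₂ : ℕ) (t : ℝ) : Matrix d d ℂ :=
  dftR (k ^ (μ₂ - μ₀)) (gmat U f k μ₀ μ₁ μ₂) t

/-- `ĝ` is `K'`-periodic. [folklore] -/
theorem ghatR_add_period (U : G →* unitaryGroup d ℂ) (f : ℕ → G) (k μ₀ μ₁ μ₂ : ℕ) (t : ℝ) (m : ℤ) :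
    ghatR U f k μ₀ μ₁ μ₂ (t + (k ^ (μ₂ - μ₀) : ℕ) * m) = ghatR U f k μ₀ μ₁ μ₂ t :=
  dftR_add_int_mul _ _ _ _

/-- **Müllner's `S₇(h₁) = ∑_{x<K'} ‖ĝ(x)ᴴ ĝ(x+h₁)‖_F²`.** [cite: Mullner2017, §5.4.2 (S₇)]
[cite: MauduitRivat2015, (74)] -/
def S7 (U : G →* unitaryGroup d ℂ) (f : ℕ → G) (k μ₀ μ₁ μ₂ : ℕ) (h₁ : ℤ) : ℝ :=
  ∑ x ∈ range (k ^ (μ₂ - μ₀)), ‖(ghatR U f k μ₀ μ₁ μ₂ x)ᴴ * ghatR U f k μ₀ μ₁ μ₂ ((x : ℝ) + h₁)‖ ^ 2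

/-- `S₇ ≥ 0`. [folklore] -/
theorem S7_nonneg (U : G →* unitaryGroup d ℂ) (f : ℕ → G) (k μ₀ μ₁ μ₂ : ℕ) (h₁ : ℤ) :
    0 ≤ S7 U f k μ₀ μ₁ μ₂ h₁ := sum_nonneg fun _ _ => sq_nonneg _

/-- **MR (81) for `S₇`**: `∑_{h₁<K'} S₇(h₁) ≤ d²` (`K' ≥ 1`): reindex `x + h₁` cyclically, then
`‖ĝ(x)ᴴĝ(y)‖ ≤ ‖ĝ(x)‖‖ĝ(y)‖` and Parseval `∑ ‖ĝ‖² = d` twice. [cite: MauduitRivat2015, (81)] -/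
theorem sum_S7_le (U : G →* unitaryGroup d ℂ) (f : ℕ → G) {k : ℕ} (hk : 0 < k) (μ₀ μ₁ μ₂ : ℕ) :
    ∑ h₁ ∈ range (k ^ (μ₂ - μ₀)), S7 U f k μ₀ μ₁ μ₂ (h₁ : ℤ) ≤ (Fintype.card d : ℝ) ^ 2 := by
  have hK' : 0 < k ^ (μ₂ - μ₀) := by positivity
  have hpar : ∑ h ∈ range (k ^ (μ₂ - μ₀)), ‖ghatR U f k μ₀ μ₁ μ₂ (h : ℝ)‖ ^ 2 = Fintype.card d := by
    have h := sum_norm_sq_ghat U f hk μ₀ μ₁ μ₂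
    simp only [ghat] at h
    simp only [ghatR]
    exact h
  -- termwise: submultiplicativity and periodicity
  have step1 : ∀ h₁ : ℕ, ∀ x : ℕ,
      ‖(ghatR U f k μ₀ μ₁ μ₂ (x : ℝ))ᴴ * ghatR U f k μ₀ μ₁ μ₂ ((x : ℝ) + ((h₁ : ℤ) : ℝ))‖ ^ 2 ≤
        ‖ghatR U f k μ₀ μ₁ μ₂ (x : ℝ)‖ ^ 2 * ‖ghatR U f k μ₀ μ₁ μ₂ (((h₁ + x) % k ^ (μ₂ - μ₀) : ℕ) : ℝ)‖ ^ 2 := by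
    intro h₁ x
    obtain ⟨q, hq⟩ : ∃ q : ℕ, (h₁ + x) / k ^ (μ₂ - μ₀) = q := ⟨_, rfl⟩
    have hdm := Nat.mod_add_div (h₁ + x) (k ^ (μ₂ - μ₀))
    rw [hq] at hdm
    have e : ((x : ℝ) + ((h₁ : ℤ) : ℝ)) = (((h₁ + x) % k ^ (μ₂ - μ₀) : ℕ) : ℝ) + (k ^ (μ₂ - μ₀) : ℕ) * (q : ℤ) := by
      have h2 := congrArg (fun n : ℕ => (n : ℝ)) hdm
      push_cast at h2 ⊢
      linarith
    rw [e, ghatR_add_period, ← mul_pow]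
    refine pow_le_pow_left₀ (norm_nonneg _) ?_ 2
    refine (Matrix.frobenius_norm_mul _ _).trans ?_
    rw [Matrix.frobenius_norm_conjTranspose]
  have step2 : ∀ x : ℕ, ∑ h₁ ∈ range (k ^ (μ₂ - μ₀)),
      ‖ghatR U f k μ₀ μ₁ μ₂ (((h₁ + x) % k ^ (μ₂ - μ₀) : ℕ) : ℝ)‖ ^ 2 = Fintype.card d := by
    intro x
    have hs := sum_range_shift_mod (k ^ (μ₂ - μ₀)) (fun y : ℕ => ‖ghatR U f k μ₀ μ₁ μ₂ (y : ℝ)‖ ^ 2) x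
    beta_reduce at hs
    rw [hs, hpar]
  unfold S7
  refine (sum_le_sum fun h₁ _ => sum_le_sum fun x _ => step1 h₁ x).trans ?_
  rw [sum_comm]
  simp_rw [← mul_sum, step2, ← sum_mul, hpar]
  rw [sq]

/-- **Lemma 10 with the adjoint on the left** (the form needed for `S₇`): under the hypotheses of
`sum_norm_sq_dftR_gmat_le` (`μ₂ = μ₀ + λ + λ'`, `ρ₃ < λ'`, `μ₀ ≤ c(λ+ρ₃)`),
`∑_{h<k^{μ₂−μ₀}} ∑_{j<k^{λ'}} ‖ĝ(h)ᴴ ĝ(h+j)‖² ≤ d · (Lemma 11 bound)`.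
[cite: MauduitRivat2015, Lemma 10] [cite: Mullner2017, Lemma 5.6] -/
theorem sum_sum_norm_sq_ghat_conj_mul_le (U : G →* unitaryGroup d ℂ) {f : ℕ → G} {k : ℕ} (hk : 2 ≤ k)
    {η C : ℝ} (hcarry : HasCarryProperty k η C f) {γ : ℝ → ℝ} {c : ℝ}
    (hF : HasFourierProperty k γ c (umat U f)) {μ₀ μ₁ μ₂ lam lam' ρ₃ : ℕ} (h01 : μ₀ ≤ μ₁)
    (hlam : μ₁ - μ₀ ≤ lam) (hsum : μ₀ + lam + lam' = μ₂) (hρ : ρ₃ < lam')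
    (hc : (μ₀ : ℝ) ≤ c * ((lam + ρ₃ : ℕ) : ℝ)) :
    ∑ h ∈ range (k ^ (μ₂ - μ₀)), ∑ j ∈ range (k ^ lam'),
        ‖(ghatR U f k μ₀ μ₁ μ₂ h)ᴴ * ghatR U f k μ₀ μ₁ μ₂ ((h + j : ℕ) : ℝ)‖ ^ 2 ≤
      Fintype.card d *
        (18 * Fintype.card d * (k ^ ρ₃ : ℕ) *
            ((k : ℝ) ^ (μ₁ - μ₀ + ρ₃) * (k : ℝ) ^ (-γ ((lam + ρ₃ : ℕ) : ℝ)) *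
              (1 + Real.log ((k : ℝ) ^ (lam + ρ₃ - (μ₁ - μ₀))))) ^ 2 +
          8 * Fintype.card d * C * (k : ℝ) ^ (-(η * ρ₃))) := by
  have hk0 : 0 < k := by omega
  have hΛ : μ₂ - μ₀ = lam + lam' := by omega
  set B : ℝ := 18 * Fintype.card d * (k ^ ρ₃ : ℕ) *
      ((k : ℝ) ^ (μ₁ - μ₀ + ρ₃) * (k : ℝ) ^ (-γ ((lam + ρ₃ : ℕ) : ℝ)) *
        (1 + Real.log ((k : ℝ) ^ (lam + ρ₃ - (μ₁ - μ₀))))) ^ 2 +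
      8 * Fintype.card d * C * (k : ℝ) ^ (-(η * ρ₃)) with hB
  have h11 : ∀ h : ℕ, ∑ j ∈ range (k ^ lam'), ‖ghatR U f k μ₀ μ₁ μ₂ ((h + j : ℕ) : ℝ)‖ ^ 2 ≤ B := by
    intro h
    have := sum_norm_sq_dftR_gmat_le U hk hcarry hF h01 hlam hsum hρ hc (h : ℝ)
    rw [← hB] at this
    refine le_of_eq_of_le (sum_congr rfl fun j _ => ?_) this
    rw [ghatR, hΛ]
    congr 2
    push_cast; ring
  calc ∑ h ∈ range (k ^ (μ₂ - μ₀)), ∑ j ∈ range (k ^ lam'),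
        ‖(ghatR U f k μ₀ μ₁ μ₂ h)ᴴ * ghatR U f k μ₀ μ₁ μ₂ ((h + j : ℕ) : ℝ)‖ ^ 2
      ≤ ∑ h ∈ range (k ^ (μ₂ - μ₀)), ∑ j ∈ range (k ^ lam'),
          ‖ghatR U f k μ₀ μ₁ μ₂ h‖ ^ 2 * ‖ghatR U f k μ₀ μ₁ μ₂ ((h + j : ℕ) : ℝ)‖ ^ 2 := by
        refine sum_le_sum fun h _ => sum_le_sum fun j _ => ?_
        rw [← mul_pow]
        refine pow_le_pow_left₀ (norm_nonneg _) ?_ 2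
        refine (Matrix.frobenius_norm_mul _ _).trans ?_
        rw [Matrix.frobenius_norm_conjTranspose]
    _ = ∑ h ∈ range (k ^ (μ₂ - μ₀)), ‖ghatR U f k μ₀ μ₁ μ₂ h‖ ^ 2 *
          ∑ j ∈ range (k ^ lam'), ‖ghatR U f k μ₀ μ₁ μ₂ ((h + j : ℕ) : ℝ)‖ ^ 2 :=
        sum_congr rfl fun h _ => by rw [mul_sum]
    _ ≤ ∑ h ∈ range (k ^ (μ₂ - μ₀)), ‖ghatR U f k μ₀ μ₁ μ₂ h‖ ^ 2 * B :=
        sum_le_sum fun h _ => mul_le_mul_of_nonneg_left (h11 h) (sq_nonneg _)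
    _ = Fintype.card d * B := by
        rw [← sum_mul]
        congr 1
        simpa [ghat, ghatR] using sum_norm_sq_ghat U f hk0 μ₀ μ₁ μ₂

end Literature.NumberTheory.LFunctions.MauduitRivat
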